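import Summits.BirchSwinnertonDyer.BirchSwinnertonDyer.Theorems.Rank2ObservatoryTamagawaExactCert
import Summits.BirchSwinnertonDyer.BirchSwinnertonDyer.Theorems.Rank2ObservatoryTamagawaIstarIntCast
import Summits.BirchSwinnertonDyer.BirchSwinnertonDyer.Theorems.Rank2ObservatoryTamagawaIzeroLocal
import HarnessLib

/-!
# BSD rank ≥ 2 observatory (`b2b-bsdr2`, cert-2 gen 11): the KERNEL certificate `TamZ` — EXACT local
# Tamagawa numbers at the primes of Kodaira type `I₀*` and `Iₙ*`, and kernel-exact rows

HONEST FRAMING: per-curve certified theorems and census instruments; no claim on BSD in rank ≥ 2.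

Theorems only (no named fact, no axiom).  Stage 1 of the census (`Rank2ObservatoryTamagawaLocal/Cert`,
`…Rank3TamagawaCensus`) certified `c_p ∈ {1, 2, 4}` at a prime of type `I₀*` and `c_p ∈ {2, 4}` at a prime
of type `Iₙ*` (`n ≥ 1`); stage 2 (`…TamagawaExactCert`, `TamX`) made `IV` / `IV*` exact.  This file makes
the remaining two types exact:
* `TamZ` — a kernel-decidable EXACT certificate on the translated equation `M = (1, r, s, t) • W₀` in the
  round-`m` normal form of Tate's Step 7 (`p ∣ a₁`, `p ∥ a₂`): `kind 5` (`n = 2m + 1`: `p^{m+2} ∣ a₃`,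
  `p^{m+3} ∣ a₄`, `p^{2m+4} ∣ a₆`, `p ∤ A₃² + 4A₆`, a root `w` of `w² + A₃w − A₆`) ⟹ `c_p = 4`;
  `kind 6` (same form, no root among `w < p`) ⟹ `c_p = 2`; `kind 7` (`n = 2m + 2`: `p^{m+3} ∣ a₃, a₄`,
  `p^{2m+5} ∣ a₆`, `p ∤ A₄² − 4A₂A₆`, a root of `A₂w² + A₄w + A₆`) ⟹ `4`; `kind 8` (no root) ⟹ `2`;
  `kind 9` = `I₀*` (Step 6 form `p ∣ a₁, a₂`, `p² ∣ a₃, a₄`, `p³ ∣ a₆`, `p ∤ disc` of Tate's cubic,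
  `w` = the number of its residue roots among `k < p`) ⟹ `c_p = w + 1`; soundness `TamZ.sound : check ⟹
  c_v = F.c` GIVEN minimality at `v`, from the local theorems `index_Istar_odd/even_intCast_eq_four/two`
  (`…TamagawaIstarLocal/Level/IntCast`) and `index_Istar_zero_intCast_eq` (`…TamagawaIzeroLocal`) through
  the plumbing `tam_eq_index_intModel` of stage 2;
* exact ROW values: `TamZ.valsZ` replaces the stage-2 value set at a prime by the singleton of a checking
  `TamZ` certificate; `tamagawaProduct_memZ` / `tamagawaProduct_eqZ`; the chunk walker `tamWalkZ` and
  `tamagawa_of_tamWalkZ` for the census supplement `Rank2ObservatoryRank3TamZ*`.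
References: J. Tate, LNM 476 (1975) §7 [Tate1975]; J. H. Silverman, *Advanced Topics*, GTM 151 (1994),
IV.9.4 Steps 6–7, Table 4.1 [Silverman1994]; J. H. Silverman, *AEC* 2nd ed. (2009), VII.1 Prop. 1.3(b),
VII.6 Ex. 7.6 [SilvermanAEC2009]; J. E. Cremona, *Algorithms for Modular Elliptic Curves* (1997) §3.2
[CremonaAlgorithms1997].
-/

set_option linter.dupNamespace false
set_option autoImplicit false

noncomputable section

open scoped NumberField Classical

open IsLocalRing IsDedekindDomain Rat.HeightOneSpectrum WeierstrassCurve
  Literature.NumberTheory.EllipticCurves Literature.NumberTheory.GaloisRepresentations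
  Literature.NumberTheory.DiophantineGeometry Literature.NumberTheory.DiophantineGeometry.TateAlgorithm

namespace Summit.BirchSwinnertonDyer.BirchSwinnertonDyer.Rank2Observatory.Tam

open Tate
open Tate.Step2Cert (pdvd pexact pdvd_iff pexact_iff)

/-! ### The kernel certificate `TamZ` -/

/-- An EXACT certificate of `c_p` at a prime of Kodaira type `Iₙ*`, `n ≥ 1` (`kind 5`: `n = 2m + 1`,
`c = 4` by a root witness `w`; `kind 6`: `n = 2m + 1`, `c = 2` by exhaustion; `kinds 7, 8`: the same for
`n = 2m + 2`) or `I₀*` (`kind 9`: `c = w + 1`, `w` = the number of residue roots of Tate's cubic), on the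
translated equation `(1, r, s, t) • W₀` in the round-`m` normal form, `pⁿ ∥ Δ`.
[cite: Silverman1994, IV.9.4 Steps 6–7] -/
structure TamZ where
  /-- the prime -/
  p : ℕ
  /-- `5`/`6` = `I₂ₘ₊₁*` root / no root; `7`/`8` = `I₂ₘ₊₂*` root / no root; `9` = `I₀*` -/
  kind : ℕ
  /-- translation `x = x' + r` -/
  r : ℤ
  /-- `y = y' + s x' + t` -/
  s : ℤ
  /-- `y = y' + s x' + t` -/
  t : ℤ
  /-- `pⁿ ∥ Δ` -/
  n : ℕ
  /-- the round of Tate's sub-procedure -/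
  m : ℕ
  /-- the root witness (kinds `5`, `7`) / the residue root count of the cubic (kind `9`) -/
  w : ℤ
  deriving Repr, DecidableEq, Inhabited

namespace TamZ

variable (F : TamZ) (W : WeierstrassCurve ℤ)

/-- The certified value of `c_p`. [cite: Silverman1994, IV.9.4 Steps 6–7] -/
def c : ℕ := if F.kind = 5 ∨ F.kind = 7 then 4 else if F.kind = 6 ∨ F.kind = 8 then 2 else F.w.toNat + 1

/-- The translated integer equation. [folklore] -/
def model : WeierstrassCurve ℤ := (⟨F.p, F.r, F.s, F.t, F.n, 0, 0⟩ : Step2Cert).model W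

/-- `A₂ = a₂ / p`. [folklore] -/
def A2 : ℤ := (F.model W).a₂ / (F.p : ℤ) ^ 1

/-- `A₃ = a₃ / p^{m+2}` (odd exit). [folklore] -/
def A3 : ℤ := (F.model W).a₃ / (F.p : ℤ) ^ (F.m + 2)

/-- `A₆ = a₆ / p^{2m+4}` (odd exit). [folklore] -/
def A6o : ℤ := (F.model W).a₆ / (F.p : ℤ) ^ (2 * (F.m + 2))

/-- `A₄ = a₄ / p^{m+3}` (even exit). [folklore] -/
def A4 : ℤ := (F.model W).a₄ / (F.p : ℤ) ^ (F.m + 3)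

/-- `A₆ = a₆ / p^{2m+5}` (even exit). [folklore] -/
def A6e : ℤ := (F.model W).a₆ / (F.p : ℤ) ^ (2 * F.m + 5)

/-- `a₄ / p²` (type `I₀*`). [folklore] -/
def B4 : ℤ := (F.model W).a₄ / (F.p : ℤ) ^ 2

/-- `a₆ / p³` (type `I₀*`). [folklore] -/
def B6 : ℤ := (F.model W).a₆ / (F.p : ℤ) ^ 3

/-- The odd-exit quadratic `w² + A₃w − A₆` at an integer. [folklore] -/
def oddVal (w : ℤ) : ℤ := w ^ 2 + F.A3 W * w - F.A6o W

/-- The even-exit quadratic `A₂w² + A₄w + A₆` at an integer. [folklore] -/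
def evenVal (w : ℤ) : ℤ := F.A2 W * w ^ 2 + F.A4 W * w + F.A6e W

/-- Tate's cubic `w³ + A₂w² + (a₄/p²)w + a₆/p³` at an integer. [folklore] -/
def cubicVal (w : ℤ) : ℤ := w ^ 3 + F.A2 W * w ^ 2 + F.B4 W * w + F.B6 W

/-- The number of residue roots of Tate's cubic among `0 ≤ k < p`. [folklore] -/
def rootCount : ℕ :=
  ((List.range F.p).filter fun k : ℕ => decide ((F.p : ℤ) ∣ F.cubicVal W (k : ℤ))).length

/-- Round-`m` normal form, odd exit: `p ∣ a₁`, `p ∥ a₂`, `p^{m+2} ∣ a₃`, `p^{m+3} ∣ a₄`, `p^{2m+4} ∣ a₆`.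
[cite: Silverman1994, IV.9.4 Step 7] -/
def normOdd : Bool :=
  pdvd F.p 1 (F.model W).a₁ && (pexact F.p 1 (F.model W).a₂ && (pdvd F.p (F.m + 2) (F.model W).a₃ &&
    (pdvd F.p (F.m + 3) (F.model W).a₄ && pdvd F.p (2 * (F.m + 2)) (F.model W).a₆)))

/-- Round-`m` normal form, even exit: `p ∣ a₁`, `p ∥ a₂`, `p^{m+3} ∣ a₃, a₄`, `p^{2m+5} ∣ a₆`.
[cite: Silverman1994, IV.9.4 Step 7] -/
def normEven : Bool :=
  pdvd F.p 1 (F.model W).a₁ && (pexact F.p 1 (F.model W).a₂ && (pdvd F.p (F.m + 3) (F.model W).a₃ &&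
    (pdvd F.p (F.m + 3) (F.model W).a₄ && pdvd F.p (2 * F.m + 5) (F.model W).a₆)))

/-- Step-6 normal form: `p ∣ a₁, a₂`, `p² ∣ a₃, a₄`, `p³ ∣ a₆`. [cite: Silverman1994, IV.9.4 Step 6] -/
def normZero : Bool :=
  pdvd F.p 1 (F.model W).a₁ && (pdvd F.p 1 (F.model W).a₂ && (pdvd F.p 2 (F.model W).a₃ &&
    (pdvd F.p 2 (F.model W).a₄ && pdvd F.p 3 (F.model W).a₆)))

/-- The kernel check: `pⁿ ∥ Δ`, the kind's normal form, separability and root test / root count.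
[cite: Silverman1994, IV.9.4 Steps 6–7] -/
def check : Bool :=
  pexact F.p F.n (F.model W).Δ &&
  ((F.kind == 5 && (F.normOdd W && (decide (¬ (F.p : ℤ) ∣ F.A3 W ^ 2 + 4 * F.A6o W) &&
      decide ((F.p : ℤ) ∣ F.oddVal W F.w)))) ||
  ((F.kind == 6 && (F.normOdd W &&
      (List.range F.p).all fun k : ℕ => !decide ((F.p : ℤ) ∣ F.oddVal W (k : ℤ)))) ||
  ((F.kind == 7 && (F.normEven W && (decide (¬ (F.p : ℤ) ∣ F.A4 W ^ 2 - 4 * F.A2 W * F.A6e W) &&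
      decide ((F.p : ℤ) ∣ F.evenVal W F.w)))) ||
  ((F.kind == 8 && (F.normEven W &&
      (List.range F.p).all fun k : ℕ => !decide ((F.p : ℤ) ∣ F.evenVal W (k : ℤ)))) ||
  (F.kind == 9 && (F.normZero W && (decide (¬ (F.p : ℤ) ∣ disc3 (F.A2 W) (F.B4 W) (F.B6 W)) &&
      decide (F.rootCount W = F.w.toNat))))))))

variable {F W}

/-- **Soundness of the kernel certificate, given minimality at `v`**: `c_v(W₀ ⊗ ℚ) = F.c`.
[cite: Tate1975, §7] [cite: Silverman1994, IV.9.4 Steps 6–7] -/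
theorem sound {W₀ : WeierstrassCurve ℤ} {F : TamZ} (v : HeightOneSpectrum (𝓞 ℚ))
    (hv : natGenerator v = F.p) (hmin : (W₀.baseChange ℚ).IsMinimalAt v) (hc : F.check W₀ = true) :
    tam W₀ v = F.c := by
  have hp : F.p.Prime := hv ▸ prime_natGenerator v
  simp only [check, normOdd, normEven, normZero, Bool.and_eq_true, Bool.or_eq_true, beq_iff_eq,
    decide_eq_true_eq, pexact_iff, pdvd_iff, List.all_eq_true, List.mem_range, Bool.not_eq_true',
    decide_eq_false_iff_not] at hc
  obtain ⟨⟨hΔn, hΔn'⟩, hkind⟩ := hc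
  have hΔM : (F.model W₀).Δ ≠ 0 := fun h0 => hΔn' (h0 ▸ dvd_zero _)
  refine tam_eq_index_intModel v hv W₀ (F.model W₀) ⟨1, F.r, F.s, F.t⟩ rfl (Step2Cert.model_eq _ W₀) hmin hΔM
    fun ε hε hpε => ?_
  have hsurj := fun y => exists_nat_residue_eq v y
  rw [hv] at hsurj
  rcases hkind with ⟨hk, ⟨h1, ⟨h2, h2'⟩, h3, h4, h6⟩, hq, hw⟩ | ⟨hk, ⟨h1, ⟨h2, h2'⟩, h3, h4, h6⟩, hno⟩ |
      ⟨hk, ⟨h1, ⟨h2, h2'⟩, h3, h4, h6⟩, hq, hw⟩ | ⟨hk, ⟨h1, ⟨h2, h2'⟩, h3, h4, h6⟩, hno⟩ |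
      ⟨hk, ⟨h1, h2, h3, h4, h6⟩, hd, hcount⟩
  · -- `I₂ₘ₊₁*`, a root: `c = 4`
    have hc' : F.c = 4 := by simp [c, hk]
    rw [hc']
    simp only [A3, A6o, oddVal] at hq hw
    exact index_Istar_odd_intCast_eq_four hp hε hpε h1 h2 h2' h3 h4 h6 hq hΔn hΔn' hw
  · -- `I₂ₘ₊₁*`, no root: `c = 2`
    have hc' : F.c = 2 := by simp [c, hk]
    rw [hc']
    simp only [A3, A6o, oddVal] at hno
    exact index_Istar_odd_intCast_eq_two hp hε hpε h1 h2 h2' h3 h4 h6 hΔn hΔn' hsurj hno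
  · -- `I₂ₘ₊₂*`, a root: `c = 4`
    have hc' : F.c = 4 := by simp [c, hk]
    rw [hc']
    simp only [A2, A4, A6e, evenVal] at hq hw
    exact index_Istar_even_intCast_eq_four hp hε hpε h1 h2 h2' h3 h4 h6 hq hΔn hΔn' hw
  · -- `I₂ₘ₊₂*`, no root: `c = 2`
    have hc' : F.c = 2 := by simp [c, hk]
    rw [hc']
    simp only [A2, A4, A6e, evenVal] at hno
    exact index_Istar_even_intCast_eq_two hp hε hpε h1 h2 h2' h3 h4 h6 hΔn hΔn' hsurj hno
  · -- `I₀*`: `c = 1 + #roots`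
    have hc' : F.c = F.rootCount W₀ + 1 := by simp [c, hk, hcount]
    rw [hc']
    unfold rootCount
    simp only [A2, B4, B6] at hd
    exact index_Istar_zero_intCast_eq (K := v.adicCompletion ℚ) hp hε hpε h1 h2 h3 h4 h6 hd hΔn hΔn'
      hsurj (fun k : ℕ => decide ((F.p : ℤ) ∣ F.cubicVal W₀ (k : ℤ))) fun k => by
        simp only [decide_eq_true_eq, cubicVal, A2, B4, B6]

/-! ### Exact rows: a `TamZ` certificate sharpens the stage-2 value set at its prime -/

/-- The sharpened local value set: the singleton `{F.c}` of the first kernel certificate at `E.p`, if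
any, else the stage-2 set `TamX.valsX Xs E`. [folklore] -/
def valsZ (Zs : List TamZ) (Xs : List TamX) (E : TamLocal) : List ℕ :=
  match Zs.find? (fun F => F.p == E.p) with
  | some F => [F.c]
  | none => TamX.valsX Xs E

/-- The sharpened finite set of values of the Tamagawa product. [folklore] -/
def rowValsZ (Es : List TamLocal) (Xs : List TamX) (Zs : List TamZ) : List ℕ :=
  valsProd (Es.map (valsZ Zs Xs))

/-- Every sharpened local set is a singleton. [folklore] -/
def rowExactZ (Es : List TamLocal) (Xs : List TamX) (Zs : List TamZ) : Bool :=
  Es.all fun E => decide ((valsZ Zs Xs E).length = 1)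

/-- The sharpened product value: the product of the heads of the local sets. [folklore] -/
def rowValueZ (Es : List TamLocal) (Xs : List TamX) (Zs : List TamZ) : ℕ :=
  (Es.map fun E => (valsZ Zs Xs E).headD 1).prod

/-- The row check with both supplements: the stage-2 row check and every `TamZ` checks. [folklore] -/
def rowCheckZ (Es : List TamLocal) (Xs : List TamX) (Zs : List TamZ) (W : WeierstrassCurve ℤ) : Bool :=
  TamX.rowCheckX Es Xs W && Zs.all fun F => F.check W

variable {Es : List TamLocal} {Xs : List TamX} {Zs : List TamZ} {W₀ : WeierstrassCurve ℤ}

/-- **Local census at a listed place, kernel-sharpened**: `c_v ∈ valsZ Zs Xs E`.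
[cite: Silverman1994, IV.9.4] -/
theorem tam_mem_valsZ_of_mem (h : rowCheckZ Es Xs Zs W₀ = true)
    (hGM : (W₀.baseChange ℚ).IsGloballyMinimal) {E : TamLocal} (hE : E ∈ Es)
    (v : HeightOneSpectrum (𝓞 ℚ)) (hv : natGenerator v = E.p) : tam W₀ v ∈ valsZ Zs Xs E := by
  simp only [rowCheckZ, Bool.and_eq_true, List.all_eq_true] at h
  unfold valsZ
  split
  · rename_i F hF
    have hFp : F.p = E.p := by simpa using List.find?_some hF
    rw [List.mem_singleton]
    exact sound v (hv.trans hFp.symm) (hGM.isMinimal v) (h.2 F (List.mem_of_find?_eq_some hF))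
  · exact TamX.tam_mem_valsX_of_mem h.1 hGM hE v hv

/-- **The Tamagawa product lies in the kernel-sharpened set** `rowValsZ Es Xs Zs`.
[cite: Silverman1994, IV.9.4] -/
theorem tamagawaProduct_memZ (h : rowCheckZ Es Xs Zs W₀ = true)
    (hGM : (W₀.baseChange ℚ).IsGloballyMinimal) :
    (W₀.baseChange ℚ).tamagawaProduct ∈ rowValsZ Es Xs Zs := by
  have h' : TamLocal.rowCheck Es W₀ = true := by
    simp only [rowCheckZ, TamX.rowCheckX, Bool.and_eq_true] at h; exact h.1.1
  obtain ⟨-, hnd, -⟩ := TamLocal.rowCheck_spec h'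
  have key : (W₀.baseChange ℚ).tamagawaProduct = (Es.map fun E => tam W₀ (pl E.p)).prod := by
    change ∏ᶠ v, tam W₀ v = _
    rw [finprod_eq_prod_map_pl (tam W₀) (Es.map (·.p)) hnd
      (fun p hp ↦ TamLocal.prime_of_mem_map h' hp) (TamLocal.tam_eq_one_of_not_mem h'), List.map_map]
    rfl
  rw [key, rowValsZ]
  refine prod_mem_valsProd ?_
  rw [List.forall₂_map_left_iff, List.forall₂_map_right_iff, List.forall₂_same]
  exact fun E hE ↦ tam_mem_valsZ_of_mem h hGM hE _
    (natGenerator_pl (TamLocal.prime_of_mem_map h' (List.mem_map.mpr ⟨E, hE, rfl⟩)))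

/-- **Exact rows, kernel-sharpened**: if every sharpened local set is a singleton, the Tamagawa
product IS `rowValueZ Es Xs Zs`. [cite: Silverman1994, IV.9.4] -/
theorem tamagawaProduct_eqZ (h : rowCheckZ Es Xs Zs W₀ = true)
    (hGM : (W₀.baseChange ℚ).IsGloballyMinimal) (hx : rowExactZ Es Xs Zs = true) :
    (W₀.baseChange ℚ).tamagawaProduct = rowValueZ Es Xs Zs := by
  have hm := tamagawaProduct_memZ h hGM
  have hvals : Es.map (valsZ Zs Xs) = (Es.map fun E => (valsZ Zs Xs E).headD 1).map fun c => [c] := by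
    rw [List.map_map]
    refine List.map_congr_left fun E hE ↦ ?_
    have h1 : (valsZ Zs Xs E).length = 1 := by simpa using List.all_eq_true.mp hx E hE
    obtain ⟨a, ha⟩ := List.length_eq_one_iff.mp h1
    simp [ha]
  rwa [rowValsZ, hvals, valsProd_map_singleton, List.mem_singleton] at hm

end TamZ

/-! ### The census walker for the kernel supplement -/

/-- One-pass position-indexed walk: the pairs `(i, Z)` (indices increasing) are checked against the
`i`-th row's integer model (every `TamZ` of `Z` checks). [folklore] -/
def tamWalkZ : List Rank3Row → ℕ → List (ℕ × List TamZ) → Bool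
  | _, _, [] => true
  | [], _, _ :: _ => false
  | r :: rs, n, (i, Z) :: rest =>
      if i = n then (Z.all fun F => F.check r.intModel) && tamWalkZ rs (n + 1) rest
      else tamWalkZ rs (n + 1) ((i, Z) :: rest)

/-- What a passing walk says about each listed pair. [folklore] -/
theorem entry_of_tamWalkZ :
    ∀ (rows : List Rank3Row) (n : ℕ) (ps : List (ℕ × List TamZ)), tamWalkZ rows n ps = true →
      ∀ (i : ℕ) (Z : List TamZ), (i, Z) ∈ ps → n ≤ i ∧ ∃ r : Rank3Row, rows[i - n]? = some r ∧
        (Z.all fun F => F.check r.intModel) = true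
  | _, _, [], _, i, Z, hm => by simp at hm
  | [], _, _ :: _, h, _, _, _ => by simp [tamWalkZ] at h
  | r :: rs, n, (j, d) :: rest, h, i, Z, hm => by
    by_cases hj : j = n
    · simp only [tamWalkZ, hj, ↓reduceIte, Bool.and_eq_true] at h
      rcases List.mem_cons.mp hm with he | hm'
      · obtain ⟨hin, hcd⟩ := Prod.mk.inj he
        rw [hj] at hin
        exact ⟨by omega, r, by rw [hin, Nat.sub_self]; rfl, by rw [hcd]; exact h.1⟩
      · obtain ⟨hle, r', hr', he'⟩ := entry_of_tamWalkZ rs (n + 1) rest h.2 i Z hm'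
        refine ⟨by omega, r', ?_, he'⟩
        rw [show i - n = (i - (n + 1)) + 1 by omega, List.getElem?_cons_succ]
        exact hr'
    · simp only [tamWalkZ, hj, ↓reduceIte] at h
      obtain ⟨hle, r', hr', he'⟩ := entry_of_tamWalkZ rs (n + 1) ((j, d) :: rest) h i Z hm
      refine ⟨by omega, r', ?_, he'⟩
      rw [show i - n = (i - (n + 1)) + 1 by omega, List.getElem?_cons_succ]
      exact hr'

/-- **The kernel-sharpened census theorem behind every supplement chunk** — NO named fact: if row
`i`'s stage-2 row certificate `(R, X)` checks (the landed censuses) and `(i, Z)` passes the kernel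
walk, then the row's TAMAGAWA PRODUCT lies in `rowValsZ R X Z` and equals `rowValueZ R X Z` when
every sharpened set is a singleton. [cite: Silverman1994, IV.9.4] [cite: CremonaAlgorithms1997, Table 1] -/
theorem tamagawa_of_tamWalkZ {ps : List (ℕ × List TamZ)} (h : tamWalkZ rank3Table 0 ps = true)
    {i : ℕ} {Z : List TamZ} (hm : (i, Z) ∈ ps) {R : List TamLocal} {X : List TamX}
    (hi : i < rank3Table.length) (hRX : TamX.rowCheckX R X (rank3Table[i]'hi).intModel = true) :
    TamZ.rowCheckZ R X Z (rank3Table[i]'hi).intModel = true ∧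
      (rank3Table[i]'hi).curve.tamagawaProduct ∈ TamZ.rowValsZ R X Z ∧
      (TamZ.rowExactZ R X Z = true →
        (rank3Table[i]'hi).curve.tamagawaProduct = TamZ.rowValueZ R X Z) := by
  obtain ⟨-, r, hrc, hc⟩ := entry_of_tamWalkZ _ 0 ps h i Z hm
  rw [Nat.sub_zero] at hrc
  obtain ⟨hi', hr⟩ := List.getElem?_eq_some_iff.mp hrc
  subst hr
  have hGM : ((rank3Table[i]'hi).intModel.baseChange ℚ).IsGloballyMinimal := by
    rw [← Rank3Row.curve_eq_baseChange]
    exact Rank3Row.isGloballyMinimal_of_mem (List.getElem_mem hi)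
  have hcz : TamZ.rowCheckZ R X Z (rank3Table[i]'hi).intModel = true := by
    simp only [TamZ.rowCheckZ, Bool.and_eq_true]; exact ⟨hRX, hc⟩
  refine ⟨hcz, ?_, fun hx ↦ ?_⟩
  · rw [Rank3Row.curve_eq_baseChange]; exact TamZ.tamagawaProduct_memZ hcz hGM
  · rw [Rank3Row.curve_eq_baseChange]; exact TamZ.tamagawaProduct_eqZ hcz hGM hx

/-! ### Kernel self-tests: the first census rows with a prime of type `I₁*`, resp. `I₁*` and `I₀*` -/

/-- Row `9` = `20888a1` (`[0,0,0,-52,100]`; bad primes `2` of type `I₁*`, `7` of type `I₂` non-split,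
`373` of type `I₁`): stage 1 certified `∏ c_p ∈ {4, 8}`; the kernel certificate (`2 ∣ w² + (a₃/4)w − a₆/16`
at `w = 0` on the translated equation `(1, 2, 0, 2) • W`, quadratic separable) makes it `∏ c_p = 8` —
evaluated IN THE KERNEL, NO named fact. [cite: Silverman1994, IV.9.4 Step 7] [cite: CremonaAlgorithms1997, Table 1] -/
theorem tamagawaProduct_20888a1 :
    (rank3Table[9]'(by rw [rank3Table_length]; omega)).curve.tamagawaProduct = 8 :=
  ((tamagawa_of_tamWalkZ (ps := [(9, [⟨2, 5, 2, 0, 2, 8, 0, 0⟩])])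
    (R := [⟨2, 1, 5, 0, 2, 0, 2, 8, 71, 0, 4⟩, ⟨7, 2, 3, 0, 0, 0, 0, 2, 0, 0, 2⟩,
      ⟨373, 19, 3, 0, 0, 0, 0, 1, 0, 0, 1⟩]) (X := [])
    (by decide +kernel) (List.mem_singleton.mpr rfl) (by rw [rank3Table_length]; omega)
    (by decide +kernel)).2.2 (by decide +kernel)).trans (by decide +kernel)

/-- Row `86` = `42264a1` (`[0,0,0,-252,1620]`; bad primes `2` of type `I₁*` (`c₂ = 4`), `3` of type `I₀*`
(Tate's cubic has three residue roots: `c₃ = 4`), `587` of type `I₁` split): stage 1 certified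
`∏ c_p ∈ {2,4}·{1,2,4}·{1}`; the kernel certificates make it `∏ c_p = 16` — IN THE KERNEL, NO named fact.
[cite: Silverman1994, IV.9.4 Steps 6–7] [cite: CremonaAlgorithms1997, Table 1] -/
theorem tamagawaProduct_42264a1 :
    (rank3Table[86]'(by rw [rank3Table_length]; omega)).curve.tamagawaProduct = 16 :=
  ((tamagawa_of_tamWalkZ (ps := [(86, [⟨2, 5, 2, 0, 2, 8, 0, 0⟩, ⟨3, 9, 0, 0, 0, 6, 0, 3⟩])])
    (R := [⟨2, 1, 5, 0, 2, 0, 2, 8, 71, 0, 4⟩, ⟨3, 1, 5, 0, 0, 0, 0, 6, 6, 0, 4⟩,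
      ⟨587, 24, 1, 523, 0, 0, 0, 1, 0, 0, 1⟩]) (X := [])
    (by decide +kernel) (List.mem_singleton.mpr rfl) (by rw [rank3Table_length]; omega)
    (by decide +kernel)).2.2 (by decide +kernel)).trans (by decide +kernel)

end Summit.BirchSwinnertonDyer.BirchSwinnertonDyer.Rank2Observatory.Tam

end
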